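import Mathlib.Analysis.SpecialFunctions.Log.Basic
import Mathlib.Algebra.Order.BigOperators.Group.Finset
import Mathlib.Algebra.Order.Field.Basic
import HarnessLib

/-!
# Roy's small value estimate for `𝔾ₐ × 𝔾ₘ` — the elementary bookkeeping of §7, Steps 2, 4 and 5

Topic `Literature/NumberTheory/Transcendental`. Part of the formalisation of the proof of Roy 2013,
Theorem 1.1 (named fact `roy2013_thm_1_1`, `RoySmallValueEstimates.lean`), seat B. Source: D. Roy,
*A small value estimate for `𝔾ₐ × 𝔾ₘ`*, Mathematika 59 (2013) 333–363 = arXiv:1301.0663, §7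
(pp. 18–19 of the arXiv text):

> (Step 2) [...] Putting all these estimates together, taking into account that `Z(ℂ)` consists
> of `deg(Z)` points, we conclude that
> `∑_{α∈𝒰} max{T log dist(α,(1:γ)), log dist(α,A_γ)} ≤ ∑_{α∈Z} log|I|_α + 7T(log T)² deg(Z)`
> [...] In particular, the set `𝒰` is not empty and contains at least one point `α₀` for which
> `log dist(α₀,(1:γ)) ≤ −D^{δ+β}/(25T)`.
> (Step 4) [...] `∑_{α∈Z} min{0, log|P*(α)|} ≥ −5(D*)^β deg(Z) − D* h(Z)` [...] thus
> `|P*(α)| ≥ 2c₄e^{−(D*)^ν/2}`, and so `log|P*(α)| ≤ 3(D*)^β + max{T* log dist, log dist_A}`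
> [...] for any subset `𝒮` of `𝒰`, `∑_{α∈𝒮} max{…} ≥ −8(D*)^β deg(Z) − D* h(Z)`.
> (Step 5) [...] for any partition of `𝒰` into `𝒰'` and `𝒰''` [...] We choose
> `𝒰' = {α ∈ 𝒰 ; T* log dist(α,(1:γ)) ≥ log dist(α,A_γ)}` [...] Combining these three
> inequalities, we obtain `−(D^δ/25)(D^β deg Z + D h(Z)) ≥ −(T/T* + 1)(8(D*)^β deg Z + D* h(Z))`.

This file isolates, as inequalities between finite sums of real numbers with all constants
symbolic, the elementary steps quoted above, so that the assembly of Theorem 1.1 only has to plug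
in the analytic estimates (Propositions 4.2, 4.5, 6.4, 6.5, Liouville) at the two levels `D, D*`:

* `sum_filter_le_sum_add` — Step 2, "putting all these estimates together";
* `exists_le_of_sum_le_neg` — Step 2, "`𝒰` is not empty and contains `α₀` with …";
* `sum_min_zero_ge` — Step 4, (7.1): `∑ min{0, xᵢ} ≥ −C₁ − d·C₂` from `0 ≤ C₁ + ∑ xᵢ`, `xᵢ ≤ C₂`;
* `le_two_mul_of_le_add`, `log_le_log_four_mul_add_max` — Step 4, "thus `|P*(α)| ≥ 2c₄e^{…}`,
  and so `log|P*(α)| ≤ … + max{T* log dist, log dist_A}`";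
* `sum_max_ge_of_pointwise` — Step 4, last display (sum over `𝒮 ⊆ 𝒰`);
* **`le_ratio_add_one_mul`** — Step 5, first display: from
  `∑_{𝒰} max{T aᵢ, bᵢ} ≤ −L` and `∀ 𝒮 ⊆ 𝒰, ∑_{𝒮} max{T* aᵢ, bᵢ} ≥ −R` one gets
  `L ≤ (T/T* + 1) R` (the input `hineq` of `RoySmallValueEndgame.endgame`).

Everything is proved (elementary real analysis); no definitions, no named facts.

## References

* [Roy2013] D. Roy, *A small value estimate for 𝔾ₐ × 𝔾ₘ*, Mathematika 59 (2013), 333–363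
  (arXiv:1301.0663), §7, Steps 2, 4, 5.
-/

noncomputable section

open Finset

namespace Literature.NumberTheory.Transcendental

namespace Roy2013

variable {ι : Type*}

/-! ### Step 2 -/

/-- **Step 2, "putting all these estimates together"**: if `g ≤ f + E` on `𝒰 ⊆ Z` and
`0 ≤ f + E` on `Z ∖ 𝒰`, then `∑_𝒰 g ≤ ∑_Z f + E · #Z`. [cite: Roy2013, §7, Step 2] -/
theorem sum_filter_le_sum_add (Z : Finset ι) (p : ι → Prop) [DecidablePred p] (f g : ι → ℝ)
    (E : ℝ) (hU : ∀ i ∈ Z, p i → g i ≤ f i + E) (hnU : ∀ i ∈ Z, ¬p i → 0 ≤ f i + E) :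
    ∑ i ∈ Z.filter p, g i ≤ ∑ i ∈ Z, f i + E * #Z := by
  have h1 : ∑ i ∈ Z.filter p, g i ≤ ∑ i ∈ Z.filter p, (f i + E) :=
    sum_le_sum fun i hi => hU i (mem_filter.mp hi).1 (mem_filter.mp hi).2
  have h2 : (0 : ℝ) ≤ ∑ i ∈ Z.filter (fun i => ¬p i), (f i + E) :=
    sum_nonneg fun i hi => hnU i (mem_filter.mp hi).1 (mem_filter.mp hi).2
  have h3 : ∑ i ∈ Z, (f i + E) = ∑ i ∈ Z, f i + E * #Z := by
    rw [sum_add_distrib, sum_const, nsmul_eq_mul, mul_comm]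
  have h4 := sum_filter_add_sum_filter_not Z p (fun i => f i + E)
  linarith

/-- **Step 2, "`𝒰` is not empty and contains a point `α₀` with `g(α₀) ≤ −M`"**: if
`∑_{𝒰} g ≤ −M d` with `M, d > 0` and `#𝒰 ≤ d`, some `α₀ ∈ 𝒰` has `g(α₀) ≤ −M`.
[cite: Roy2013, §7, Step 2] -/
theorem exists_le_of_sum_le_neg (U : Finset ι) (g : ι → ℝ) {M d : ℝ} (hM : 0 < M) (hd0 : 0 < d)
    (hd : (#U : ℝ) ≤ d) (h : ∑ i ∈ U, g i ≤ -(M * d)) : ∃ i ∈ U, g i ≤ -M := by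
  by_contra hcon
  push Not at hcon
  rcases U.eq_empty_or_nonempty with hU | ⟨i₀, hi₀⟩
  · subst hU
    simp only [sum_empty] at h
    nlinarith
  · have h1 : ∑ i ∈ U, (-M) < ∑ i ∈ U, g i :=
      sum_lt_sum (fun i hi => (hcon i hi).le) ⟨i₀, hi₀, hcon i₀ hi₀⟩
    rw [sum_const, nsmul_eq_mul] at h1
    nlinarith

/-! ### Step 4 -/

/-- **Step 4, (7.1)**: from `0 ≤ C₁ + ∑_Z xᵢ` and `xᵢ ≤ C₂` (`C₂ ≥ 0`) one gets
`∑_Z min{0, xᵢ} ≥ −C₁ − #Z · C₂`. [cite: Roy2013, §7, Step 4, (7.1)] -/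
theorem sum_min_zero_ge (Z : Finset ι) (x : ι → ℝ) {C₁ C₂ : ℝ} (hC₂ : 0 ≤ C₂)
    (h0 : 0 ≤ C₁ + ∑ i ∈ Z, x i) (hx : ∀ i ∈ Z, x i ≤ C₂) :
    -(C₁ + #Z * C₂) ≤ ∑ i ∈ Z, min 0 (x i) := by
  have h1 : ∀ i ∈ Z, x i - C₂ ≤ min 0 (x i) := fun i hi =>
    le_min (by linarith [hx i hi]) (by linarith)
  have h2 : ∑ i ∈ Z, (x i - C₂) ≤ ∑ i ∈ Z, min 0 (x i) := sum_le_sum h1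
  rw [sum_sub_distrib, sum_const, nsmul_eq_mul] at h2
  linarith

/-- The sum of `min{0, xᵢ}` over a subset dominates the sum over the whole set, and is dominated
by the plain sum over the subset. [folklore] -/
theorem sum_min_zero_subset_le {S Z : Finset ι} (hSZ : S ⊆ Z) (x : ι → ℝ) :
    ∑ i ∈ Z, min 0 (x i) ≤ ∑ i ∈ S, x i := by
  classical
  have h1 := sum_sdiff hSZ (f := fun i => min 0 (x i))
  have h2 : ∑ i ∈ Z \ S, min 0 (x i) ≤ 0 := sum_nonpos fun i _ => min_le_left _ _
  have h3 : ∑ i ∈ S, min 0 (x i) ≤ ∑ i ∈ S, x i := sum_le_sum fun i _ => min_le_right _ _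
  linarith

/-- **Step 4, "thus `|P*(α)| ≥ 2c₄e^{−(D*)^ν/2}`, and so …"**, first half: if
`x ≤ cB + M(p + q)` and `2cB ≤ x` then `x ≤ 2M(p + q)`. [cite: Roy2013, §7, Step 4] -/
theorem le_two_mul_of_le_add {x c B M p q : ℝ} (h : x ≤ c * B + M * (p + q))
    (h2 : 2 * (c * B) ≤ x) : x ≤ 2 * (M * (p + q)) := by linarith

/-- **Step 4, second half**: for `x > 0` with `x ≤ 2M(p^T + q)` (`M, p, q > 0`),
`log x ≤ log(4M) + max{T log p, log q}`. [cite: Roy2013, §7, Step 4] -/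
theorem log_le_log_four_mul_add_max {x M p q : ℝ} {T : ℕ} (hx : 0 < x) (hM : 0 < M)
    (hp : 0 < p) (hq : 0 < q) (h : x ≤ 2 * (M * (p ^ T + q))) :
    Real.log x ≤ Real.log (4 * M) + max (T * Real.log p) (Real.log q) := by
  have hm : p ^ T + q ≤ 2 * max (p ^ T) q := by
    rcases le_total (p ^ T) q with hle | hle
    · rw [max_eq_right hle]; linarith
    · rw [max_eq_left hle]; linarith
  have h1 : x ≤ 4 * M * max (p ^ T) q := by nlinarith
  have hmax0 : 0 < max (p ^ T) q := lt_max_of_lt_right hq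
  calc Real.log x ≤ Real.log (4 * M * max (p ^ T) q) := Real.log_le_log hx h1
    _ = Real.log (4 * M) + Real.log (max (p ^ T) q) := Real.log_mul (by positivity) hmax0.ne'
    _ = Real.log (4 * M) + max (T * Real.log p) (Real.log q) := by
        congr 1
        rcases le_total (p ^ T) q with hle | hle
        · rw [max_eq_right hle, max_eq_right]
          rw [← Real.log_pow]; exact Real.log_le_log (pow_pos hp T) hle
        · rw [max_eq_left hle, max_eq_left, Real.log_pow]
          rw [← Real.log_pow]; exact Real.log_le_log hq hle

/-- **Step 4, last display**: if `yᵢ ≥ xᵢ − E` on `𝒮 ⊆ Z` and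
`∑_Z min{0, xᵢ} ≥ −C`, then `∑_𝒮 yᵢ ≥ −C − #𝒮 · E`. [cite: Roy2013, §7, Step 4] -/
theorem sum_max_ge_of_pointwise {S Z : Finset ι} (hSZ : S ⊆ Z) (x y : ι → ℝ) {C E : ℝ}
    (hC : -C ≤ ∑ i ∈ Z, min 0 (x i)) (hxy : ∀ i ∈ S, x i - E ≤ y i) :
    -(C + #S * E) ≤ ∑ i ∈ S, y i := by
  have h1 : ∑ i ∈ S, (x i - E) ≤ ∑ i ∈ S, y i := sum_le_sum hxy
  rw [sum_sub_distrib, sum_const, nsmul_eq_mul] at h1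
  have h2 := sum_min_zero_subset_le hSZ x
  linarith

/-! ### Step 5 -/

/-- **Step 5, "combining these three inequalities"**: if `∑_{𝒰} max{T aᵢ, bᵢ} ≤ −L` and
`∑_{𝒮} max{T* aᵢ, bᵢ} ≥ −R` for every `𝒮 ⊆ 𝒰` (`T ≥ 0`, `T* > 0`), then
`L ≤ (T/T* + 1) R`: split `𝒰` into `𝒰' = {T* aᵢ ≥ bᵢ}` and its complement.
[cite: Roy2013, §7, Step 5 (first display)] -/
theorem le_ratio_add_one_mul (U : Finset ι) (a b : ι → ℝ) {T Ts L R : ℝ} (hT : 0 ≤ T)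
    (hTs : 0 < Ts) (h2 : ∑ i ∈ U, max (T * a i) (b i) ≤ -L)
    (h4 : ∀ S ⊆ U, -R ≤ ∑ i ∈ S, max (Ts * a i) (b i)) : L ≤ (T / Ts + 1) * R := by
  classical
  set U' := U.filter (fun i => b i ≤ Ts * a i) with hU'
  set U'' := U.filter (fun i => ¬(b i ≤ Ts * a i)) with hU''
  -- Step 2 side
  have hsplit := sum_filter_add_sum_filter_not U (fun i => b i ≤ Ts * a i)
    (fun i => max (T * a i) (b i))
  have hA : ∑ i ∈ U', T * a i ≤ ∑ i ∈ U', max (T * a i) (b i) :=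
    sum_le_sum fun i _ => le_max_left _ _
  have hB : ∑ i ∈ U'', b i ≤ ∑ i ∈ U'', max (T * a i) (b i) :=
    sum_le_sum fun i _ => le_max_right _ _
  -- Step 4 side on `U'` and `U''`
  have h4' := h4 U' (filter_subset _ _)
  have h4'' := h4 U'' (filter_subset _ _)
  have hE' : ∑ i ∈ U', max (Ts * a i) (b i) = Ts * ∑ i ∈ U', a i := by
    rw [mul_sum]
    exact sum_congr rfl fun i hi => max_eq_left (mem_filter.mp hi).2
  have hE'' : ∑ i ∈ U'', max (Ts * a i) (b i) = ∑ i ∈ U'', b i :=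
    sum_congr rfl fun i hi => max_eq_right (le_of_lt (not_le.mp (mem_filter.mp hi).2))
  rw [hE'] at h4'
  rw [hE''] at h4''
  -- `T ∑_{U'} a = (T/T*) (T* ∑_{U'} a) ≥ -(T/T*) R`
  have hTa : -(T / Ts * R) ≤ ∑ i ∈ U', T * a i := by
    rw [← mul_sum]
    have h1 : T * ∑ i ∈ U', a i = T / Ts * (Ts * ∑ i ∈ U', a i) := by
      field_simp
    rw [h1, ← mul_neg]
    exact mul_le_mul_of_nonneg_left h4' (div_nonneg hT hTs.le)
  have : L ≤ T / Ts * R + R := by linarith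
  linarith

end Roy2013

end Literature.NumberTheory.Transcendental
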